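import Mathlib
import Summits.ValiantsHypothesis.ValiantsHypothesis.Theorems.FeketeSOSSublinearShadowWindowReduction

/-!
# `FeketeSOS.SublinearShadow` (stmt-ValiantsHypothesis-14990), line `Sketch` — the WINDOW TRANSFER

`stub_windowTransfer`: an identity `w · F_p = Σ_{k<n} λ_k q_k²` over a commutative ring `R` together with a
ring map `ψ : R → Λ = K[T]/(T^(v+1))` (`char K = p`) with `ψ(w) ≠ 0` gives a cyclic characteristic-`p` shadow of
`F̄_p = Σ_{m<p} (m|p) X^m` over `K' = K̄` with `≤ (2v+2)·n` weighted squares of degree `< p` and total support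
`≤ (2v+2)·Σ_k |supp q_k|`.

Proof (pure algebra).  Write every element of `Λ` as its canonical representative of `T`-degree `≤ v`
(`AdjoinRoot.modByMonicHom`, the "digits").  Let `t₀ ≤ v` be the `T`-degree of the representative `P` of
`ψ(w)` and `u₀ ≠ 0` its top coefficient.  Push the identity through the single ring map
`Ψ : R[X] → B = K'[X][Π]/(Π^(t₀+1))` (`X ↦ X`, `r ↦` the digit expansion of `ψ(r)` in `Π`, scalars extended to
`K'`): both sides become classes of explicit polynomials in `K'[X][Π]` — `P(Π) · F̄_p(X)` on the left and
`Σ_k γ_k(Π) Y_k(Π, X)²` on the right, with `γ_k, Y_k` the (truncated) digit expansions of `λ_k, q_k`, whose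
`X`-supports lie inside `supp q_k`.  Equality in `B` means equality of the `Π^t`-coefficients for `t ≤ t₀`;
the `Π^(t₀)`-coefficient gives the window identity `(Σ_k γ_k Y_k²)_{t₀} = u₀ · F̄_p`, i.e. a window model of
order `t₀` over the algebraically closed field `K'`, and the landed window reduction `shadow_of_window`
finishes (`2t₀ + 2 ≤ 2v + 2`).
-/

namespace Summit.ValiantsHypothesis.ValiantsHypothesis.Theorems.SublinearShadowSketch

-- `Summit.ValiantsHypothesis.ValiantsHypothesis.…` is the tree's mandated single-conjunct layout (Sub = Summit).
set_option linter.dupNamespace false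

open Polynomial Finset
open scoped BigOperators

/-- Two polynomials with the same class modulo `X^n` have the same coefficients of index `< n`. -/
theorem wtr_coeff_eq_of_mk_eq {A : Type*} [CommRing A] {n : ℕ} {f₁ f₂ : A[X]}
    (h : AdjoinRoot.mk (X ^ n) f₁ = AdjoinRoot.mk (X ^ n) f₂) {d : ℕ} (hd : d < n) :
    f₁.coeff d = f₂.coeff d := by
  have := X_pow_dvd_iff.mp (AdjoinRoot.mk_eq_mk.mp h) d hd
  rwa [coeff_sub, sub_eq_zero] at this

/-- Coefficients of the truncation of a polynomial below `X^n`. -/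
theorem wtr_coeff_trunc {A : Type*} [CommSemiring A] (n : ℕ) (f : A[X]) (d : ℕ) :
    (PowerSeries.trunc n (f : PowerSeries A)).coeff d = if d < n then f.coeff d else 0 := by
  rw [PowerSeries.coeff_trunc, Polynomial.coeff_coe]

/-- Truncating below `X^n` and then mapping the coefficients does not change the class modulo `X^n`. -/
theorem wtr_mk_trunc_map {A B : Type*} [CommSemiring A] [CommRing B] (i : A →+* B) (n : ℕ)
    (f : A[X]) :
    AdjoinRoot.mk (X ^ n) ((PowerSeries.trunc n (f : PowerSeries A)).map i)
      = AdjoinRoot.mk (X ^ n) (f.map i) := by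
  refine AdjoinRoot.mk_eq_mk.mpr (X_pow_dvd_iff.mpr fun d hd => ?_)
  rw [coeff_sub, coeff_map, coeff_map, wtr_coeff_trunc, if_pos hd, sub_self]

/-- Truncating below `X^n` does not change the class modulo `X^n`. -/
theorem wtr_mk_trunc {A : Type*} [CommRing A] (n : ℕ) (f : A[X]) :
    AdjoinRoot.mk (X ^ n) (PowerSeries.trunc n (f : PowerSeries A)) = AdjoinRoot.mk (X ^ n) f := by
  refine AdjoinRoot.mk_eq_mk.mpr (X_pow_dvd_iff.mpr fun d hd => ?_)
  rw [coeff_sub, wtr_coeff_trunc, if_pos hd, sub_self]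

/-- In `A[X]/(G)`, evaluating `f` at the root with scalars embedded by `AdjoinRoot.of` is the class of `f`. -/
theorem wtr_eval₂_of_root {A : Type*} [CommRing A] (G f : A[X]) :
    f.eval₂ (AdjoinRoot.of G) (AdjoinRoot.root G) = AdjoinRoot.mk G f := by
  rw [← AdjoinRoot.algebraMap_eq, ← aeval_def, AdjoinRoot.aeval_eq]

/-- The `X`-support of a finite sum `Σ_{i ∈ s} C(a_i) X^i` lies inside `s`. -/
theorem wtr_support_sum_C_mul_X_pow {A : Type*} [Semiring A] (s : Finset ℕ) (a : ℕ → A) :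
    (∑ i ∈ s, C (a i) * X ^ i).support ⊆ s := by
  classical
  intro e he
  rw [mem_support_iff, finsetSum_coeff] at he
  simp only [coeff_C_mul_X_pow, Finset.sum_ite_eq] at he
  by_contra hes
  exact he (if_neg hes)

/-- **Window transfer, core.**  Digit extraction: an identity `w · F_p = Σ_{k<n} λ_k q_k²` over `R` and a ring
map `ψ : R → K[T]/(T^(v+1))` with `ψ(w) ≠ 0` give, over any algebraically closed field `K'` of characteristic `p`
containing `K`, a cyclic shadow of `F̄_p` with `≤ (2v+2)·n` squares of degree `< p` and total support
`≤ (2v+2)·Σ_k |supp q_k|`. -/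
theorem wtr_core (p : ℕ) [Fact p.Prime] {R : Type} [CommRing R] (n : ℕ) (lam : Fin n → R)
    (q : Fin n → R[X]) (w : R)
    (hrep : C w * (∑ m ∈ Finset.range p, C ((legendreSym p m : ℤ) : R) * X ^ m) = ∑ k, C (lam k) * q k ^ 2)
    (K : Type) [Field K] (v : ℕ) (ψ : R →+* AdjoinRoot ((X : K[X]) ^ (v + 1))) (hw : ψ w ≠ 0)
    (K' : Type) [Field K'] [CharP K' p] [IsAlgClosed K'] (ι : K →+* K') :
    ∃ (d : ℕ) (c' : Fin d → K') (g' : Fin d → Polynomial K'),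
      d ≤ (2 * v + 2) * n ∧ (∀ j, (g' j).natDegree < p) ∧
      (∑ j, (g' j).support.card) ≤ (2 * v + 2) * ∑ k, (q k).support.card ∧
      ((X : Polynomial K') ^ p - 1 ∣ (∑ j, C (c' j) * g' j ^ 2)
        - ∑ m ∈ Finset.range p, C ((legendreSym p m : ℤ) : K') * X ^ m) := by
  classical
  -- (1) digits: canonical representatives of `T`-degree `≤ v` in `Λ = K[T]/(T^(v+1))`
  have hg : ((X : K[X]) ^ (v + 1)).Monic := monic_X_pow _
  set rep := AdjoinRoot.modByMonicHom hg with hrep_def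
  have hmk_rep : ∀ x, AdjoinRoot.mk _ (rep x) = x := AdjoinRoot.mk_leftInverse hg
  -- the representative `P` of `ψ w`, its degree `t₀ ≤ v` and its (nonzero) top digit
  set P : K[X] := rep (ψ w) with hP_def
  have hP0 : P ≠ 0 := fun h => hw (by rw [← hmk_rep (ψ w), ← hP_def, h, map_zero])
  obtain ⟨t₀, ht₀P⟩ : ∃ t₀ : ℕ, t₀ = P.natDegree := ⟨_, rfl⟩
  have ht₀ : t₀ ≤ v := by
    obtain ⟨f, hf⟩ := AdjoinRoot.mk_surjective (ψ w)
    have hPf : P = f %ₘ (X ^ (v + 1)) := by rw [hP_def, ← hf, hrep_def, AdjoinRoot.modByMonicHom_mk]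
    have h1 : P.natDegree < ((X : K[X]) ^ (v + 1)).natDegree :=
      natDegree_lt_natDegree hP0 (hPf ▸ degree_modByMonic_lt f hg)
    rw [natDegree_X_pow] at h1
    omega
  have hu₀ : P.coeff t₀ ≠ 0 := by
    rw [ht₀P, coeff_natDegree]; exact leadingCoeff_ne_zero.mpr hP0
  -- (2) the ring `B = K'[X][Π]/(Π^(t₀+1))` and the ring map `φ : Λ → B` (scalars extended along `ι`)
  set j₀ : K →+* K'[X] := (C : K' →+* K'[X]).comp ι with hj₀
  have hroot : ((X : K[X]) ^ (v + 1)).eval₂ ((AdjoinRoot.of ((X : K'[X][X]) ^ (t₀ + 1))).comp j₀)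
      (AdjoinRoot.root ((X : K'[X][X]) ^ (t₀ + 1))) = 0 := by
    rw [eval₂_X_pow]
    have h0 : AdjoinRoot.root ((X : K'[X][X]) ^ (t₀ + 1)) ^ (t₀ + 1) = 0 := by
      rw [← AdjoinRoot.mk_X, ← map_pow, AdjoinRoot.mk_self]
    calc AdjoinRoot.root ((X : K'[X][X]) ^ (t₀ + 1)) ^ (v + 1)
        = AdjoinRoot.root ((X : K'[X][X]) ^ (t₀ + 1)) ^ (t₀ + 1)
            * AdjoinRoot.root ((X : K'[X][X]) ^ (t₀ + 1)) ^ (v - t₀) := by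
          rw [← pow_add]; congr 1; omega
      _ = 0 := by rw [h0, zero_mul]
  obtain ⟨φ, hφ_def⟩ : ∃ φ : AdjoinRoot ((X : K[X]) ^ (v + 1)) →+* AdjoinRoot ((X : K'[X][X]) ^ (t₀ + 1)),
      φ = AdjoinRoot.lift _ _ hroot := ⟨_, rfl⟩
  have hφ : ∀ x, φ x = AdjoinRoot.mk _ ((rep x).map j₀) := by
    intro x
    conv_lhs => rw [← hmk_rep x]
    rw [hφ_def, AdjoinRoot.lift_mk, ← eval₂_map, wtr_eval₂_of_root]
  -- the ring map `Ψ : R[X] → B`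
  obtain ⟨Ψ, hΨ⟩ : ∃ Ψ : R[X] →+* AdjoinRoot ((X : K'[X][X]) ^ (t₀ + 1)),
      Ψ = eval₂RingHom (φ.comp ψ) (AdjoinRoot.of _ X) := ⟨_, rfl⟩
  have hΨC : ∀ r, Ψ (C r) = AdjoinRoot.mk _ ((rep (ψ r)).map j₀) := by
    intro r; rw [hΨ, coe_eval₂RingHom, eval₂_C, RingHom.comp_apply, hφ]
  have hΨX : Ψ X = AdjoinRoot.of _ X := by rw [hΨ, coe_eval₂RingHom, eval₂_X]
  -- (3) the window model over `K'`: truncated digit expansions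
  obtain ⟨Y₀, hY₀⟩ : ∃ Y₀ : Fin n → K'[X][X],
      ∀ k, Y₀ k = ∑ i ∈ (q k).support, (rep (ψ ((q k).coeff i))).map j₀ * C (X ^ i) :=
    ⟨_, fun _ => rfl⟩
  obtain ⟨Y, hY⟩ : ∃ Y : Fin n → K'[X][X],
      ∀ k, Y k = PowerSeries.trunc (t₀ + 1) (Y₀ k : PowerSeries K'[X]) := ⟨_, fun _ => rfl⟩
  obtain ⟨γ, hγ⟩ : ∃ γ : Fin n → K'[X],
      ∀ k, γ k = PowerSeries.trunc (t₀ + 1) (((rep (ψ (lam k))).map ι : K'[X]) : PowerSeries K') :=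
    ⟨_, fun _ => rfl⟩
  set F' : K'[X] := ∑ m ∈ Finset.range p, C ((legendreSym p m : ℤ) : K') * X ^ m with hF'
  have hΨq : ∀ k, Ψ (q k) = AdjoinRoot.mk _ (Y k) := by
    intro k
    rw [hY k, wtr_mk_trunc, hY₀ k]
    conv_lhs => rw [(q k).as_sum_support_C_mul_X_pow]
    simp only [map_sum, map_mul, map_pow, hΨC, hΨX, AdjoinRoot.mk_C]
  have hΨγ : ∀ k, Ψ (C (lam k)) = AdjoinRoot.mk _ ((γ k).map C) := by
    intro k
    rw [hΨC, hγ k, wtr_mk_trunc_map, Polynomial.map_map]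
  have hΨF : Ψ (∑ m ∈ Finset.range p, C ((legendreSym p m : ℤ) : R) * X ^ m) = AdjoinRoot.mk _ (C F') := by
    rw [hF']
    simp only [map_sum, map_mul, map_pow, hΨX, AdjoinRoot.mk_C, map_intCast]
  -- (4) the identity in `B` and its `Π^(t₀)`-coefficient: the window identity
  have key : AdjoinRoot.mk ((X : K'[X][X]) ^ (t₀ + 1)) (P.map j₀ * C F')
      = AdjoinRoot.mk ((X : K'[X][X]) ^ (t₀ + 1)) (∑ k, (γ k).map C * Y k ^ 2) := by
    calc AdjoinRoot.mk ((X : K'[X][X]) ^ (t₀ + 1)) (P.map j₀ * C F')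
        = Ψ (C w * ∑ m ∈ Finset.range p, C ((legendreSym p m : ℤ) : R) * X ^ m) := by
          rw [map_mul Ψ, hΨC, hΨF, ← map_mul]
      _ = Ψ (∑ k, C (lam k) * q k ^ 2) := by rw [hrep]
      _ = AdjoinRoot.mk ((X : K'[X][X]) ^ (t₀ + 1)) (∑ k, (γ k).map C * Y k ^ 2) := by
          simp only [map_sum, map_mul, map_pow, hΨγ, hΨq]
  have hlayer : (∑ k, (γ k).map (C : K' →+* K'[X]) * Y k ^ 2).coeff t₀ = C (ι (P.coeff t₀)) * F' := by
    rw [← wtr_coeff_eq_of_mk_eq key (Nat.lt_succ_self t₀), coeff_mul_C, coeff_map, hj₀,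
      RingHom.comp_apply]
  -- (5) the hypotheses of the window reduction
  have hu : ι (P.coeff t₀) ≠ 0 := (map_ne_zero ι).mpr hu₀
  have hγd : ∀ k, (γ k).natDegree ≤ t₀ := fun k => by
    rw [hγ k]; exact Nat.lt_succ_iff.mp (PowerSeries.natDegree_trunc_lt _ _)
  have hYd : ∀ k, (Y k).natDegree ≤ t₀ := fun k => by
    rw [hY k]; exact Nat.lt_succ_iff.mp (PowerSeries.natDegree_trunc_lt _ _)
  have hsupp : ∀ k m, ((Y k).coeff m).support ⊆ (q k).support := by
    intro k m
    rw [hY k, wtr_coeff_trunc]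
    split_ifs with hm
    · rw [hY₀ k]
      simp only [finsetSum_coeff, coeff_mul_C, coeff_map, hj₀, RingHom.comp_apply]
      exact wtr_support_sum_C_mul_X_pow _ _
    · simp
  -- (6) the window reduction over `K'`, at order `t₀ ≤ v`
  obtain ⟨d, c', g', hd, hdeg, hcard, hdvd⟩ :=
    shadow_of_window p K' n t₀ (fun k => (q k).support) γ Y (ι (P.coeff t₀)) hu hγd hYd hsupp hlayer
  refine ⟨d, c', g', ?_, hdeg, ?_, hdvd⟩
  · calc d ≤ (2 * t₀ + 2) * n := hd
      _ ≤ (2 * v + 2) * n := Nat.mul_le_mul_right n (by omega)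
  · calc ∑ j, (g' j).support.card ≤ (2 * t₀ + 2) * ∑ k, (q k).support.card := hcard
      _ ≤ (2 * v + 2) * ∑ k, (q k).support.card := Nat.mul_le_mul_right _ (by omega)

/-- **Stub (W3): WINDOW TRANSFER.**  An identity `w · F_p = Σ_{k<n} λ_k q_k²` over a commutative ring `R` and a
ring map `ψ : R → K[T]/(T^(v+1))` (`char K = p`) with `ψ(w) ≠ 0` give a cyclic characteristic-`p` shadow of `F̄_p`
with `≤ (2v+2)·n` weighted squares of degree `< p` and total support `≤ (2v+2)·Σ_k |supp q_k|` (digit extraction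
in `K[T]/(T^(v+1))`, base change to `K̄`, and the landed window reduction `shadow_of_window`). -/
theorem stub_windowTransfer (p : ℕ) [Fact p.Prime] {R : Type} [CommRing R] (n : ℕ) (lam : Fin n → R)
    (q : Fin n → R[X]) (w : R)
    (hrep : C w * (∑ m ∈ Finset.range p, C ((legendreSym p m : ℤ) : R) * X ^ m) = ∑ k, C (lam k) * q k ^ 2)
    (K : Type) [Field K] [CharP K p] (v : ℕ) (ψ : R →+* AdjoinRoot ((X : K[X]) ^ (v + 1))) (hw : ψ w ≠ 0) :
    ∃ (K' : Type) (_ : Field K') (_ : CharP K' p) (d : ℕ) (c' : Fin d → K') (g' : Fin d → Polynomial K'),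
      d ≤ (2 * v + 2) * n ∧ (∀ j, (g' j).natDegree < p) ∧
      (∑ j, (g' j).support.card) ≤ (2 * v + 2) * ∑ k, (q k).support.card ∧
      ((X : Polynomial K') ^ p - 1 ∣ (∑ j, C (c' j) * g' j ^ 2)
        - ∑ m ∈ Finset.range p, C ((legendreSym p m : ℤ) : K') * X ^ m) := by
  obtain ⟨d, c', g', h⟩ :=
    wtr_core p n lam q w hrep K v ψ hw (AlgebraicClosure K) (algebraMap K (AlgebraicClosure K))
  exact ⟨AlgebraicClosure K, inferInstance, inferInstance, d, c', g', h⟩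

end Summit.ValiantsHypothesis.ValiantsHypothesis.Theorems.SublinearShadowSketch
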